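import Literature.NumberTheory.NumberFields.RayClassFieldSplitPrimePowerDegree
import Literature.NumberTheory.GaloisRepresentations.RestrictedRamificationUnramifiedSubfields
import HarnessLib

/-!
# `v`-adic Artin values above a modulus `𝔪`: `σ|_{K(𝔪vⁿ)} = [⟨u⟩_v, K]|_{K(𝔪vⁿ)}` for all `n` —
# EXISTENCE for `σ ∈ Gal(K̄/K(𝔪))` (Shimura's step) and UNIQUENESS under `w_𝔪 = 1`
# (de Shalit 1987, II.1.7–1.9 / I.3.3 (9), by class field theory; part 1 of 2)

De Shalit, *Iwasawa theory of elliptic curves with complex multiplication* (1987), II.1.7–1.9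
(p. 41–43) and II.4.6 (p. 59): for an imaginary quadratic `K`, an integral ideal `𝔣` with `w_𝔣 = 1`
(no unit `≠ 1` is `≡ 1 mod 𝔣`) and a prime `𝔭 ∤ 𝔣`, Artin reciprocity identifies
`Gal(K(𝔣𝔭^∞)/K(𝔣)) ≅ 𝒪_𝔭ˣ` (`≅ ℤ_pˣ` for `𝔭` split), the layer `K(𝔣𝔭ⁿ)` being cut out by the
principal units `1 + 𝔭ⁿ𝒪_𝔭`; this is the isomorphism "`κ : G ≃ ℤ_p^×`" of I.3.3 (9) along which the
measures of I.3 / II.4 are pulled back to the Galois group ((9)–(10), II.4.6–4.7).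

The measure side of the tree consumes exactly this shape ABSTRACTLY
(`ProfiniteGroupDistributionCharacterCells.lean`: a character `κ : G →* ℤ_pˣ` with
`hU : σ ∈ U_n ↔ σ ∈ U_0 ∧ κ σ ≡ 1 mod p^{n+1}` and the surjectivity `hκ`;
`PAdicOneVariableSeriesFamilyOfCharacter.lean` etc.), and its docstring leaves "that for `K`
imaginary quadratic, `𝔭` split, `U_n = Gal(K̄/K(𝔣𝔭^{n+1}))` and `κ` the `𝔭`-adic character … the
hypotheses `hU` and `hκ` hold (de Shalit II.1.7–1.9, `w_𝔣 = 1`)" to the class-field-theory lane.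
This file and its sequel `RayClassFieldAdicCharacter.lean` supply it from the tree's PROVED global
class field theory (`IdelicArtinMap.lean`: Shimura's `[a, K]`; `RayClassFieldIdelic.lean`:
`C_𝔪 = rayClassField K 𝔪`, `[a, K] = 1` on `C_𝔪` iff `a ∈ Kˣ·W_𝔪`), for ANY totally complex number
field `K`, any `𝔪 ≠ 0` with `w_𝔪 = 1` and any finite place `v ∤ 𝔪`. THIS FILE (part 1):

* §1 `principalIdeles_inf_rayUnitIdeles_eq_bot` — `w_𝔪 = 1` ⟹ `Kˣ ∩ W_𝔪 = 1` (the uniqueness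
  engine); the `v`-component bookkeeping `mul_inv_localUnits_rayComponent_mem_rayUnitIdeles_mul_pow`
  (`e ∈ W_𝔪` ⟹ `e·⟨e_v⟩_v⁻¹ ∈ W_{𝔪vⁿ}`), `localUnits_integer_mem_rayUnitIdeles_mul_pow_iff`
  (`⟨u⟩_v ∈ W_{𝔪vⁿ} ↔ |u − 1|_v ≤ |vⁿ|`) and `localUnits_integer_mem_sup_rayUnitIdeles_mul_pow_iff`
  (`⟨u⟩_v ∈ Kˣ·W_{𝔪vⁿ} ↔ ⟨u⟩_v ∈ W_{𝔪vⁿ}`).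
* §2 `IsAdicArtinValue 𝔪 v σ u` := `σ|_{C_{𝔪vⁿ}} = [⟨u⟩_v, K]|_{C_{𝔪vⁿ}}` for all `n`;
  ★ EXISTENCE for every `σ ∈ Gal(K̄/K(𝔪))` (`exists_isAdicArtinValue`: write `σ = [s, K]`, then
  `s = d·e`, `d ∈ Kˣ`, `e ∈ W_𝔪`, and `u := e_v`), ★ UNIQUENESS (`IsAdicArtinValue.unique`, from §1),
  and `IsAdicArtinValue.mem_ker_iff_mem_sup` (a value at level `n` decides `σ|_{C_{𝔪vⁿ}}`).

Two small definitions with body (`rayComponent`, the predicate `IsAdicArtinValue`); theorems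
otherwise; no named facts, no instances, no `sorry`. The subgroup `Gal(K̄/K(𝔪))` is
`(absRestrictNormalHom (rayClassField K 𝔪)).ker` (`= (rayClassField K 𝔪).fixingSubgroup`,
`ker_absRestrictNormalHom_eq_fixingSubgroup`), as in `DeShalit1987.rayClassTower`.

## References

* [deShalit1987] E. de Shalit, *Iwasawa theory of elliptic curves with complex multiplication*
  (1987), I.3.3 (9) (p. 18), II.1.7–1.9 (p. 41–43), II.4.6 (p. 59).
* [NeukirchANT1999] J. Neukirch, *Algebraic Number Theory* (1999), Ch. VI §1 (1.7)–(1.9), §6 (6.2),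
  §7 (7.1).
* [Shimura1998] G. Shimura, *Abelian Varieties with Complex Multiplication and Modular Functions*
  (1998), §18.6 proof, p. 128 (`c = s d e`).
-/

noncomputable section

open NumberField IsDedekindDomain IsDedekindDomain.HeightOneSpectrum Field
open scoped nonZeroDivisors Classical

namespace Literature.NumberTheory.NumberFields

open Literature.NumberTheory.GaloisRepresentations
open Literature.NumberTheory.Automorphic (FiniteAdeleRing.unitOrd FiniteAdeleRing.unitOrd_eq_zero_iff)
open Literature.NumberTheory.ComplexMultiplication.EllipticUnits (rayUnitIdeles_anti_of_le)

variable {K : Type} [Field K] [NumberField K]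

/-! ### §1. Preliminaries: `Kˣ ∩ W_𝔪 = 1`, the `v`-component, the levels `W_{𝔪vⁿ}` -/

section Prelim

variable {𝔪 : Ideal (𝓞 K)} {v : HeightOneSpectrum (𝓞 K)}

/-- **`w_𝔪 = 1` ⟹ `Kˣ ∩ W_𝔪 = 1`** (`K` totally complex): a principal idele in `W_𝔪 = I_K^𝔪` is the
idele of a global unit `≡ 1 mod 𝔪`, hence `1` when no unit other than `1` is `≡ 1 mod 𝔪` — the
injectivity half of de Shalit's II.1.7 count `[K(𝔣) : K] = h·Φ(𝔣)/w_𝔣` read at `w_𝔣 = 1`.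
[cite: deShalit1987, II.1.7 (p. 41)] [cite: NeukirchANT1999, Ch. VI §1 Prop. (1.9) (proof) p. 365] -/
theorem principalIdeles_inf_rayUnitIdeles_eq_bot [IsTotallyComplex K] (h𝔪 : 𝔪 ≠ ⊥)
    (hw : ∀ u : (𝓞 K)ˣ, (u : 𝓞 K) - 1 ∈ 𝔪 → u = 1) :
    principalIdeles K ⊓ rayUnitIdeles K 𝔪 = ⊥ := by
  rw [eq_bot_iff]
  rintro x ⟨⟨a, rfl⟩, hx⟩
  change principalIdele K a ∈ rayUnitIdeles K 𝔪 at hx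
  rw [rayUnitIdeles_eq_congruenceUnitIdeles h𝔪, mem_congruenceUnitIdeles_iff] at hx
  obtain ⟨ε, hε⟩ := exists_units_eq_of_mem_unitIdeles hx.2
  have hray : a ∈ rayElements 𝔪 := principalIdele_mem_congruenceIdeles_iff.mp hx.1
  have hεa : Units.map (algebraMap (𝓞 K) K : 𝓞 K →* K) ε = a := Units.ext hε
  have hε1 : ε = 1 := units_eq_one_of_mem_rayElements h𝔪 hw ε (hεa ▸ hray)
  rw [Subgroup.mem_bot, show a = 1 by rw [← hεa, hε1, map_one], map_one]

/-- `W_𝔪 ≤ 𝕌_K`, so an idele of `W_𝔪` has a unit `v`-component `e_v ∈ 𝒪_vˣ`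
(`unitIdeles.localUnit`). [cite: NeukirchANT1999, Ch. VI §1 Def. (1.7)] -/
def rayComponent (v : HeightOneSpectrum (𝓞 K)) (e : ideleGroup K) (he : e ∈ rayUnitIdeles K 𝔪) :
    (v.adicCompletionIntegers K)ˣ :=
  unitIdeles.localUnit v ⟨e, rayUnitIdeles_le_unitIdeles he⟩

/-- The `v`-component, as an element of `K_v`, is the `v`-coordinate of the idele.
[cite: NeukirchANT1999, Ch. VI §1 Def. (1.7)] -/
@[simp] theorem coe_rayComponent (e : ideleGroup K) (he : e ∈ rayUnitIdeles K 𝔪) :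
    (((rayComponent v e he : (v.adicCompletionIntegers K)ˣ) : v.adicCompletionIntegers K) :
      v.adicCompletion K) = (e : AdeleRing (𝓞 K) K).2 v :=
  rfl

/-- The idele `⟨u⟩_v` of a local unit `u ∈ 𝒪_vˣ` (`u` at `v`, `1` elsewhere), as used throughout.
[cite: Shimura1998, §18.6 proof, p. 128] -/
theorem localUnits_integer_snd_self (u : (v.adicCompletionIntegers K)ˣ) :
    ((localUnits v (Units.map ((v.adicCompletionIntegers K).subtype : _ →* _) u) : ideleGroup K) :
      AdeleRing (𝓞 K) K).2 v = ((u : v.adicCompletionIntegers K) : v.adicCompletion K) :=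
  localUnits_snd_apply_self v _

/-- `ord_w (𝔪vⁿ) = ord_w 𝔪 + n·[w = v]`. [cite: NeukirchANT1999, Ch. VI §1 Def. (1.7)] -/
theorem count_mul_pow_eq (h𝔪 : 𝔪 ≠ ⊥) (n : ℕ) (w : HeightOneSpectrum (𝓞 K)) :
    FractionalIdeal.count K w ((𝔪 * v.asIdeal ^ n : Ideal (𝓞 K)) : FractionalIdeal (𝓞 K)⁰ K) =
      FractionalIdeal.count K w (𝔪 : FractionalIdeal (𝓞 K)⁰ K) + if w = v then (n : ℤ) else 0 := by
  rw [FractionalIdeal.coeIdeal_mul, FractionalIdeal.coeIdeal_pow,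
    FractionalIdeal.count_mul K w (FractionalIdeal.coeIdeal_ne_zero.mpr h𝔪)
      (pow_ne_zero _ (FractionalIdeal.coeIdeal_ne_zero.mpr v.ne_bot)),
    FractionalIdeal.count_pow, FractionalIdeal.count_maximal]
  by_cases hw : w = v
  · subst hw; simp
  · rw [if_neg (Ne.symm hw), if_neg hw, mul_zero]

/-- **`⟨u⟩_v ∈ W_{𝔪vⁿ} ↔ |u − 1|_v ≤ |vⁿ|_v`** for a local unit `u ∈ 𝒪_vˣ` at `v ∤ 𝔪` (`𝔪 ≠ 0`): the
idele `⟨u⟩_v` satisfies the congruences of `W_{𝔪vⁿ}` away from `v` trivially, and at `v` the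
condition is `u ≡ 1 mod vⁿ`. [cite: NeukirchANT1999, Ch. VI §1 Def. (1.7)] [cite: deShalit1987, II.1.9 (p. 43)] -/
theorem localUnits_integer_mem_rayUnitIdeles_mul_pow_iff (h𝔪 : 𝔪 ≠ ⊥) (hv : ¬ 𝔪 ≤ v.asIdeal)
    (n : ℕ) (u : (v.adicCompletionIntegers K)ˣ) :
    localUnits v (Units.map ((v.adicCompletionIntegers K).subtype : _ →* _) u) ∈
        rayUnitIdeles K (𝔪 * v.asIdeal ^ n) ↔
      Valued.v (((u : v.adicCompletionIntegers K) : v.adicCompletion K) - 1) ≤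
        WithZero.exp (-(n : ℤ)) := by
  have h0 : FractionalIdeal.count K v (𝔪 : FractionalIdeal (𝓞 K)⁰ K) = 0 := by
    rw [FractionalIdeal.count_coe K v h𝔪, Nat.cast_eq_zero]
    by_contra hne
    exact hv (Ideal.dvd_iff_le.mp ((Associates.count_ne_zero_iff_dvd h𝔪 v.irreducible).mp hne))
  have hmem := localUnits_integer_mem_rayUnitIdeles h𝔪 hv u
  rw [mem_rayUnitIdeles_iff] at hmem ⊢
  constructor
  · intro h
    have h1 := (h v).2
    rwa [count_mul_pow_eq h𝔪, if_pos rfl, h0, zero_add, localUnits_integer_snd_self] at h1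
  · intro h w
    refine ⟨(hmem w).1, ?_⟩
    rw [count_mul_pow_eq h𝔪]
    by_cases hw : w = v
    · subst hw
      rwa [if_pos rfl, h0, zero_add, localUnits_integer_snd_self]
    · rw [if_neg hw, add_zero]
      exact (hmem w).2

/-- **`e ∈ W_𝔪 ⟹ e·⟨e_v⟩_v⁻¹ ∈ W_{𝔪vⁿ}` for every `n`**: dividing out the `v`-component leaves an
idele with `v`-coordinate `1` and the old coordinates elsewhere (Shimura's `e` modified at one
prime). [cite: Shimura1998, §18.6 proof, p. 128] [cite: NeukirchANT1999, Ch. VI §1 Def. (1.7)] -/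
theorem mul_inv_localUnits_rayComponent_mem_rayUnitIdeles_mul_pow (h𝔪 : 𝔪 ≠ ⊥) (n : ℕ)
    (e : ideleGroup K) (he : e ∈ rayUnitIdeles K 𝔪) :
    e * (localUnits v (Units.map ((v.adicCompletionIntegers K).subtype : _ →* _)
        (rayComponent v e he)))⁻¹ ∈ rayUnitIdeles K (𝔪 * v.asIdeal ^ n) := by
  set c := localUnits v (Units.map ((v.adicCompletionIntegers K).subtype : _ →* _)
    (rayComponent v e he)) with hc_def
  have hev := (mem_rayUnitIdeles_iff e).mp he
  have heU : e ∈ unitIdeles K := rayUnitIdeles_le_unitIdeles he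
  -- coordinates of `e * c⁻¹`
  have hcv : (c : AdeleRing (𝓞 K) K).2 v = (e : AdeleRing (𝓞 K) K).2 v := by
    rw [hc_def, localUnits_integer_snd_self, coe_rayComponent]
  have hv1 : ((e * c⁻¹ : ideleGroup K) : AdeleRing (𝓞 K) K).2 v = 1 := by
    rw [ideleGroup_val_snd_mul, ideleGroup_val_inv_snd, hcv,
      mul_inv_cancel₀ (ideleGroup_snd_ne_zero e v)]
  have hw1 : ∀ w, w ≠ v → ((e * c⁻¹ : ideleGroup K) : AdeleRing (𝓞 K) K).2 w =
      (e : AdeleRing (𝓞 K) K).2 w := fun w hw ↦ by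
    rw [ideleGroup_val_snd_mul, ideleGroup_val_inv_snd, hc_def, localUnits_snd_apply_of_ne _ hw,
      inv_one, mul_one]
  rw [mem_rayUnitIdeles_iff]
  intro w
  rw [count_mul_pow_eq h𝔪]
  by_cases hw : w = v
  · subst hw
    have hord : FiniteAdeleRing.unitOrd (𝓞 K) K (IdeleAction.finitePart K (e * c⁻¹)) w = 0 := by
      rw [FiniteAdeleRing.unitOrd_eq_zero_iff]
      change Valued.v (((e * c⁻¹ : ideleGroup K) : AdeleRing (𝓞 K) K).2 w) = 1
      rw [hv1, map_one]
    refine ⟨hord, ?_⟩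
    rw [hv1, sub_self, map_zero]
    exact zero_le
  · have hord : FiniteAdeleRing.unitOrd (𝓞 K) K (IdeleAction.finitePart K (e * c⁻¹)) w = 0 := by
      rw [FiniteAdeleRing.unitOrd_eq_zero_iff]
      change Valued.v (((e * c⁻¹ : ideleGroup K) : AdeleRing (𝓞 K) K).2 w) = 1
      rw [hw1 w hw]
      exact heU w
    refine ⟨hord, ?_⟩
    rw [hw1 w hw, if_neg hw, add_zero]
    exact (hev w).2

/-- **`Kˣ ∩ W_𝔪 = 1` makes `⟨u⟩_v` honest**: for a local unit `u` at `v ∤ 𝔪` (so `⟨u⟩_v ∈ W_𝔪`),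
`⟨u⟩_v ∈ Kˣ·W_{𝔪vⁿ}` already forces `⟨u⟩_v ∈ W_{𝔪vⁿ}` — writing `⟨u⟩_v = d·e'` the principal `d`
lies in `Kˣ ∩ W_𝔪 = 1`. [cite: deShalit1987, II.1.7 (p. 41)] [cite: NeukirchANT1999, Ch. VI §1 Prop. (1.9) (proof) p. 365] -/
theorem localUnits_integer_mem_sup_rayUnitIdeles_mul_pow_iff [IsTotallyComplex K] (h𝔪 : 𝔪 ≠ ⊥)
    (hv : ¬ 𝔪 ≤ v.asIdeal) (hw : ∀ u : (𝓞 K)ˣ, (u : 𝓞 K) - 1 ∈ 𝔪 → u = 1) (n : ℕ)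
    (u : (v.adicCompletionIntegers K)ˣ) :
    localUnits v (Units.map ((v.adicCompletionIntegers K).subtype : _ →* _) u) ∈
        principalIdeles K ⊔ rayUnitIdeles K (𝔪 * v.asIdeal ^ n) ↔
      localUnits v (Units.map ((v.adicCompletionIntegers K).subtype : _ →* _) u) ∈
        rayUnitIdeles K (𝔪 * v.asIdeal ^ n) := by
  refine ⟨fun h ↦ ?_, fun h ↦ Subgroup.mem_sup_right h⟩
  obtain ⟨d, hd, e, he, hde⟩ := Subgroup.mem_sup.mp h
  set c := localUnits v (Units.map ((v.adicCompletionIntegers K).subtype : _ →* _) u) with hc_def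
  have hle : rayUnitIdeles K (𝔪 * v.asIdeal ^ n) ≤ rayUnitIdeles K 𝔪 :=
    rayUnitIdeles_anti_of_le (mul_ne_zero h𝔪 (pow_ne_zero _ v.ne_bot)) Ideal.mul_le_right
  have hc : c ∈ rayUnitIdeles K 𝔪 := localUnits_integer_mem_rayUnitIdeles h𝔪 hv u
  -- `d = c e⁻¹ ∈ Kˣ ∩ W_𝔪 = 1`
  have hd' : d = c * e⁻¹ := by rw [← hde, mul_inv_cancel_right]
  have hd1 : d ∈ principalIdeles K ⊓ rayUnitIdeles K 𝔪 := by
    refine Subgroup.mem_inf.mpr ⟨hd, ?_⟩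
    rw [hd']
    exact Subgroup.mul_mem _ hc (Subgroup.inv_mem _ (hle he))
  rw [principalIdeles_inf_rayUnitIdeles_eq_bot h𝔪 hw, Subgroup.mem_bot] at hd1
  rw [← hde, hd1, one_mul]
  exact he

/-- In a discretely valued field, an element all of whose "congruences" `|y| ≤ |vⁿ|` hold is `0`
(`⋂ₙ 𝔭̂ⁿ = 0`). [cite: NeukirchANT1999, Ch. II §3 Prop. (3.8)] -/
theorem eq_zero_of_forall_valued_le_exp_neg {y : v.adicCompletion K}
    (h : ∀ n : ℕ, Valued.v y ≤ WithZero.exp (-(n : ℤ))) : y = 0 := by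
  by_contra hy
  have hne : Valued.v y ≠ 0 := (Valuation.ne_zero_iff _).mpr hy
  set m : ℤ := WithZero.log (Valued.v y) with hm
  have hym : Valued.v y = WithZero.exp m := (WithZero.exp_log hne).symm
  obtain ⟨n, hn⟩ := exists_nat_gt (-m)
  have h1 := h n
  rw [hym, WithZero.exp_le_exp] at h1
  omega

end Prelim

/-! ### §2. The characterising predicate: existence (Shimura's step) and uniqueness (`w_𝔪 = 1`) -/

section Value

variable (𝔪 : Ideal (𝓞 K)) (v : HeightOneSpectrum (𝓞 K))

/-- **`u ∈ 𝒪_vˣ` is a `v`-adic Artin value of `σ` above `𝔪`**: `σ` and the Artin symbol `[⟨u⟩_v, K]`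
of the idele `⟨u⟩_v` (`u` at `v`, `1` elsewhere) agree on EVERY layer `C_{𝔪vⁿ} = K(𝔪vⁿ)`, `n ≥ 0`,
of the `v`-ray class tower above `K(𝔪)` (de Shalit's `σ(ω) = [κ(σ)]_f(ω)`, II.1.7 / I.3.3 (9), read
through Artin reciprocity). [cite: deShalit1987, I.3.3 (9) (p. 18), II.1.7 (p. 41)]
[cite: NeukirchANT1999, Ch. VI §7 Thm. (7.1)] -/
def IsAdicArtinValue (σ : absoluteGaloisGroup K) (u : (v.adicCompletionIntegers K)ˣ) : Prop :=
  ∀ n : ℕ, absRestrictNormalHom (rayClassField K (𝔪 * v.asIdeal ^ n)) σ =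
    abRestrict (rayClassField K (𝔪 * v.asIdeal ^ n))
      (ideleArtinMap K (localUnits v (Units.map ((v.adicCompletionIntegers K).subtype : _ →* _) u)))

variable {𝔪 v}

/-- Unfolding `IsAdicArtinValue`. [cite: deShalit1987, I.3.3 (9) (p. 18)] -/
theorem isAdicArtinValue_iff {σ : absoluteGaloisGroup K} {u : (v.adicCompletionIntegers K)ˣ} :
    IsAdicArtinValue 𝔪 v σ u ↔ ∀ n : ℕ, absRestrictNormalHom (rayClassField K (𝔪 * v.asIdeal ^ n)) σ =
      abRestrict (rayClassField K (𝔪 * v.asIdeal ^ n))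
        (ideleArtinMap K (localUnits v (Units.map ((v.adicCompletionIntegers K).subtype : _ →* _) u))) :=
  Iff.rfl

/-- `1` is a value of `1`. [cite: deShalit1987, I.3.3 (9) (p. 18)] -/
theorem IsAdicArtinValue.one : IsAdicArtinValue 𝔪 v (1 : absoluteGaloisGroup K) 1 := by
  intro n
  rw [map_one, map_one, map_one, map_one, map_one]

/-- Values multiply: `[⟨u u'⟩_v, K] = [⟨u⟩_v, K]·[⟨u'⟩_v, K]`. [cite: deShalit1987, I.3.3 (9) (p. 18)] -/
theorem IsAdicArtinValue.mul {σ τ : absoluteGaloisGroup K} {u u' : (v.adicCompletionIntegers K)ˣ}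
    (hσ : IsAdicArtinValue 𝔪 v σ u) (hτ : IsAdicArtinValue 𝔪 v τ u') :
    IsAdicArtinValue 𝔪 v (σ * τ) (u * u') := by
  intro n
  rw [map_mul, hσ n, hτ n, map_mul, map_mul, map_mul, map_mul]

/-- **EXISTENCE (Shimura's step `s = d·e`)**: every `σ ∈ Gal(K̄/K(𝔪))` has a `v`-adic Artin value —
write `σ = [s, K]` (`[·, K]` is onto), then `σ|_{C_𝔪} = 1` gives `s = d·e` with `d ∈ Kˣ`, `e ∈ W_𝔪`,
and `u := e_v` works at EVERY level since `e·⟨e_v⟩_v⁻¹ ∈ W_{𝔪vⁿ}` for all `n`.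
[cite: Shimura1998, §18.6 proof, p. 128] [cite: NeukirchANT1999, Ch. VI §7 Thm. (7.1)] -/
theorem exists_isAdicArtinValue (h𝔪 : 𝔪 ≠ ⊥) {σ : absoluteGaloisGroup K}
    (hσ : σ ∈ (absRestrictNormalHom (rayClassField K 𝔪)).ker) :
    ∃ u : (v.adicCompletionIntegers K)ˣ, IsAdicArtinValue 𝔪 v σ u := by
  obtain ⟨s, hs⟩ := exists_ideleArtinMap_eq σ
  have h1 : abRestrict (rayClassField K 𝔪) (ideleArtinMap K s) = 1 := by
    rw [hs, abRestrict_absGaloisAbProj]; exact hσ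
  obtain ⟨d, hd, e, he, rfl⟩ :=
    Subgroup.mem_sup.mp ((abRestrict_ideleArtinMap_rayClassField_eq_one_iff s).mp h1)
  refine ⟨rayComponent v e he, fun n ↦ ?_⟩
  set c := localUnits v (Units.map ((v.adicCompletionIntegers K).subtype : _ →* _)
    (rayComponent v e he)) with hc_def
  have he' : e * c⁻¹ ∈ rayUnitIdeles K (𝔪 * v.asIdeal ^ n) :=
    mul_inv_localUnits_rayComponent_mem_rayUnitIdeles_mul_pow h𝔪 n e he
  have h2 : abRestrict (rayClassField K (𝔪 * v.asIdeal ^ n)) (ideleArtinMap K (e * c⁻¹)) = 1 :=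
    (abRestrict_ideleArtinMap_rayClassField_eq_one_iff _).mpr (Subgroup.mem_sup_right he')
  rw [← abRestrict_absGaloisAbProj, ← hs, map_mul, map_mul,
    ideleArtinMap_eq_one_of_mem_principalIdeles hd, map_one, one_mul,
    show e = e * c⁻¹ * c by rw [inv_mul_cancel_right], map_mul, map_mul, h2, one_mul]

/-- **A value at level `n` decides `σ|_{C_{𝔪vⁿ}}`**: `σ ∈ Gal(K̄/K(𝔪vⁿ))` iff `⟨u⟩_v ∈ Kˣ·W_{𝔪vⁿ}`.
[cite: NeukirchANT1999, Ch. VI §7 Thm. (7.1)] -/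
theorem IsAdicArtinValue.mem_ker_iff_mem_sup {σ : absoluteGaloisGroup K}
    {u : (v.adicCompletionIntegers K)ˣ} (h : IsAdicArtinValue 𝔪 v σ u) (n : ℕ) :
    σ ∈ (absRestrictNormalHom (rayClassField K (𝔪 * v.asIdeal ^ n))).ker ↔
      localUnits v (Units.map ((v.adicCompletionIntegers K).subtype : _ →* _) u) ∈
        principalIdeles K ⊔ rayUnitIdeles K (𝔪 * v.asIdeal ^ n) := by
  rw [MonoidHom.mem_ker, h n, abRestrict_ideleArtinMap_rayClassField_eq_one_iff]

/-- **UNIQUENESS (`w_𝔪 = 1`)**: two `v`-adic Artin values of the same `σ` above `𝔪` coincide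
(`K` totally complex, `v ∤ 𝔪`): their quotient `w` has `[⟨w⟩_v, K] = 1` on every `C_{𝔪vⁿ}`, so
`⟨w⟩_v ∈ Kˣ·W_{𝔪vⁿ}`, so (`Kˣ ∩ W_𝔪 = 1`) `⟨w⟩_v ∈ W_{𝔪vⁿ}`, i.e. `w ≡ 1 mod vⁿ` for all `n`.
[cite: deShalit1987, II.1.7 (p. 41)] [cite: NeukirchANT1999, Ch. VI §1 Prop. (1.9) (proof) p. 365] -/
theorem IsAdicArtinValue.unique [IsTotallyComplex K] (h𝔪 : 𝔪 ≠ ⊥) (hv : ¬ 𝔪 ≤ v.asIdeal)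
    (hw : ∀ u : (𝓞 K)ˣ, (u : 𝓞 K) - 1 ∈ 𝔪 → u = 1) {σ : absoluteGaloisGroup K}
    {u₁ u₂ : (v.adicCompletionIntegers K)ˣ} (h₁ : IsAdicArtinValue 𝔪 v σ u₁)
    (h₂ : IsAdicArtinValue 𝔪 v σ u₂) : u₁ = u₂ := by
  -- `w = u₁ u₂⁻¹` is a value of `1`
  have hw1 : IsAdicArtinValue 𝔪 v 1 (u₁ * u₂⁻¹) := by
    intro n
    have e1 := h₁ n
    have e2 := h₂ n
    rw [map_one, map_mul, map_mul, map_mul, map_mul, ← e1, map_inv, map_inv, map_inv, map_inv, ← e2,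
      mul_inv_cancel]
  have hval : ∀ n : ℕ, Valued.v ((((u₁ * u₂⁻¹ : (v.adicCompletionIntegers K)ˣ) :
      v.adicCompletionIntegers K) : v.adicCompletion K) - 1) ≤ WithZero.exp (-(n : ℤ)) := fun n ↦ by
    rw [← localUnits_integer_mem_rayUnitIdeles_mul_pow_iff h𝔪 hv,
      ← localUnits_integer_mem_sup_rayUnitIdeles_mul_pow_iff h𝔪 hv hw, ← hw1.mem_ker_iff_mem_sup]
    exact one_mem _
  have h0 := eq_zero_of_forall_valued_le_exp_neg hval
  rw [sub_eq_zero] at h0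
  have h1 : (u₁ * u₂⁻¹ : (v.adicCompletionIntegers K)ˣ) = 1 := by
    apply Units.ext
    apply Subtype.ext
    rw [h0]; rfl
  rwa [mul_inv_eq_one] at h1

end Value

end Literature.NumberTheory.NumberFields

end
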